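import Literature.Topology.FourManifolds.CircleNbhdFraming
import Literature.Topology.FourManifolds.CircleSurgerySymmetries
import Literature.Topology.FourManifolds.StraighteningInvariance
import Literature.Topology.FourManifolds.GompfTheorem43Proofs
import Literature.Topology.FourManifolds.GompfConjInvariance
import Mathlib.Analysis.InnerProductSpace.Projection.FiniteDimensional
import HarnessLib

/-!
# S — the framings of the section circle of the Cappell–Shaneson mapping torus (Gompf 2010, §4 ¶2)

This file discharges the named fact `Literature.Topology.FourManifolds.gompf2010_sectionCircle_framings`
(**S**, `GompfFramedSpheres.lean`): every circle surgery on the concrete Cappell–Shaneson mapping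
torus `CSTorus A` along the standard section circle — any parametrisation `c` of it, any tubular
neighbourhood `ν`, any realisation `X` of the surgery gluing — is diffeomorphic to one of Gompf's
concrete spheres `X^σ_A = gompfSphere A γ` (R. Gompf, *More Cappell–Shaneson spheres are standard*,
Algebr. Geom. Topol. 10 (2010), §4 ¶2: "the two straightenings `σ` … canonically determine the two
possible isotopy classes … and hence the two resulting diffeomorphism types, which we denote by
`X^σ`. (For each `σ` we straighten and then surger with the untwisted framing. Changing the framing
is equivalent to changing `σ`.)"; the underlying differential topology is the uniqueness of
tubular neighbourhoods, Kosinski, *Differential Manifolds*, III.3, and of surgery on a framed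
circle, Gompf–Stipsicz, *4-Manifolds and Kirby Calculus*, §5.2).

## Proof

Fix a framing path `γ₀` and write `c₀ = sectionCircle A γ₀`, `ν₀ = sectionCircleNbhd A γ₀`.
1. *Parametrisation* (`CircleSurgerySymmetries.lean`): `IsCircleSurgery T X c → IsCircleSurgery T X c₀`
   (`IsCircleSurgery.of_range_eq`), so `X ≅ ν.Surgered` for some tube `ν` of `c₀`.
2. *Tubular neighbourhood uniqueness* (`CircleNbhdFraming.lean`):
   `ν.Surgered ≅ (ν₀.linTwist L).Surgered` for a smooth loop `L : 𝕊¹ → GL(3, ℝ)`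
   (`CircleNbhd.exists_opLoop_nonempty_diffeomorph_surgered`).
3. *Orientation* (`CircleSurgerySymmetries.lean`): reflecting the fibre does not change the
   surgery, so we may assume `det L(ptA) > 0` (`Submodule.det_reflection`).
4. *Realisation by a framing path* (this file): for `det L(ptA) > 0` put
   `γ₁ = γ₀ · (L(ptA)⁻¹ L(e^{2πiτ}))` (`τ` Mathlib's smooth transition; a smooth matrix path
   from `1` to `A`); the Gompf tube of `γ₁` is `ν₀` reframed, up to `1`-jet, by the loop
   `u ↦ κ · L(ptA)⁻¹ L(e^{2πi τ(2 angA u)})` (`κ` the ratio of the tube radii) — the jet lemma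
   (`TubeJet.lean`) and the computation of `GompfTubeMoves.lean` without the closeness
   hypothesis — and this loop is connected to `L` by a continuous family of smooth loops
   (rescale `κ ⇝ 1`, move `L(ptA)⁻¹ ⇝ 1` inside `GL⁺(3, ℝ)`, undo the reparametrisation
   `τ(2·) ⇝ id`), so `TubeLinearReframe`'s family lemma identifies the surgeries.
Consequently the named fact `gompf2010_straightening_classification` holds as well
(`gompf2010_straightening_classification_holds`), and the geometric leaf set of
`nonempty_diffeomorph_sphere_four_of_isCappellShanesonSphereOf` shrinks to the framed Theorem 2.1
(**F**, **F₀**) and [AK1] (`nonempty_diffeomorph_sphere_four_of_isCappellShanesonSphereOf_of_twist_AK`).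

## References
* R. E. Gompf, *More Cappell–Shaneson spheres are standard*, AGT 10 (2010) 1665–1681, §4 ¶2. [GompfAGT2010]
* R. E. Gompf, A. I. Stipsicz, *4-Manifolds and Kirby Calculus*, GSM 20 (1999), §5.2. [GompfStipsiczGSM1999]
* A. Kosinski, *Differential Manifolds* (1993), Ch. III §3, Thm (3.1), (3.5). [Kosinski1993]
-/

noncomputable section

open scoped Manifold ContDiff Topology Real Matrix.Norms.Operator
open Set Function Metric OpenPartialHomeomorph

namespace Literature.Topology.FourManifolds

universe u

/-- Local notation: `𝔼 n` is the model Euclidean space `EuclideanSpace ℝ (Fin n)`. -/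
local notation "𝔼 " n:arg => EuclideanSpace ℝ (Fin n)

/-- Local notation: `𝕊 n` is the unit sphere in `EuclideanSpace ℝ (Fin (n + 1))`. -/
local notation "𝕊 " n:arg => (Metric.sphere (0 : EuclideanSpace ℝ (Fin (n + 1))) 1 : Set _)

attribute [local instance] fact_finrank_euclideanSpace_two

/-! ### The derivative of the shrinking map `univBall 0 ε` at the origin -/

section UnivBall

variable {E : Type*} [NormedAddCommGroup E] [InnerProductSpace ℝ E]

/-- **`D (univUnitBall) (0) = id`**: `univUnitBall x = (1 + ‖x‖²)^{-1/2} x`, a smooth scalar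
equal to `1` at `0` times the identity. [folklore] -/
theorem hasFDerivAt_univUnitBall_zero :
    HasFDerivAt (univUnitBall : E → E) (ContinuousLinearMap.id ℝ E) 0 := by
  have hc : ContDiff ℝ ∞ fun x : E ↦ (Real.sqrt (1 + ‖x‖ ^ 2))⁻¹ :=
    ((contDiff_const.add (contDiff_norm_sq ℝ)).sqrt fun x ↦ (by positivity : (1 + ‖x‖ ^ 2) ≠ 0)).inv
      fun x ↦ (Real.sqrt_pos.2 (by positivity)).ne'
  have hcd : HasFDerivAt (fun x : E ↦ (Real.sqrt (1 + ‖x‖ ^ 2))⁻¹)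
      (fderiv ℝ (fun x : E ↦ (Real.sqrt (1 + ‖x‖ ^ 2))⁻¹) 0) 0 :=
    ((hc.differentiable (by simp)) 0).hasFDerivAt
  have h := hcd.smul (hasFDerivAt_id (0 : E))
  have heq : (univUnitBall : E → E) = fun x ↦ (Real.sqrt (1 + ‖x‖ ^ 2))⁻¹ • id x :=
    funext fun x ↦ by rw [univUnitBall_apply, id]
  rw [heq]
  refine h.congr_fderiv ?_
  ext v
  simp

/-- **`D (univBall 0 ε) (0) = ε · id`.** [folklore] -/
theorem hasFDerivAt_univBall_zero {ε : ℝ} (hε : 0 < ε) :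
    HasFDerivAt (univBall (0 : E) ε) (ε • ContinuousLinearMap.id ℝ E) 0 := by
  have heq : (univBall (0 : E) ε : E → E) = fun x ↦ ε • univUnitBall x := by
    funext x
    rw [univBall_zero_eq_smul hε, univUnitBall_apply]
  rw [heq]
  exact hasFDerivAt_univUnitBall_zero.const_smul ε

/-- The derivative of `univBall 0 ε` at `0` as a continuous linear equivalence `ε · id`
(inverse `ε⁻¹ · id`). [folklore] -/
def univBallDeriv {ε : ℝ} (hε : 0 < ε) : E ≃L[ℝ] E :=
  ContinuousLinearEquiv.equivOfInverse (ε • ContinuousLinearMap.id ℝ E) (ε⁻¹ • ContinuousLinearMap.id ℝ E)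
    (fun v ↦ by simp [smul_smul, mul_inv_cancel₀ hε.ne'])
    (fun v ↦ by simp [smul_smul, inv_mul_cancel₀ hε.ne'])

/-- **`D (univBall 0 ε)⁻¹ (0) = ε⁻¹ · id`** (inverse function). [folklore] -/
theorem hasFDerivAt_univBall_symm_zero {ε : ℝ} (hε : 0 < ε) :
    HasFDerivAt (univBall (0 : E) ε).symm (ε⁻¹ • ContinuousLinearMap.id ℝ E) 0 := by
  have h0 : (0 : E) ∈ (univBall (0 : E) ε).target := by
    rw [univBall_target _ hε]
    exact mem_ball_self hε
  have hd : HasFDerivAt (univBall (0 : E) ε) (univBallDeriv (E := E) hε : E →L[ℝ] E)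
      ((univBall (0 : E) ε).symm 0) := by
    rw [univBall_symm_apply_center]
    exact hasFDerivAt_univBall_zero hε
  exact (univBall (0 : E) ε).hasFDerivAt_symm h0 hd

end UnivBall

/-! ### Operators and matrices -/

section ToMat

/-- Local notation: `𝕄` is the algebra of real `3 × 3` matrices. -/
local notation "𝕄" => Matrix (Fin 3) (Fin 3) ℝ

/-- **The matrix of an operator on `𝔼 3`** (inverse of `matCLM = Matrix.toEuclideanCLM`), bundled
as a continuous linear map so that the entries of a smooth operator family are visibly smooth
(`contDiff_toMat_apply`); as a bare function it is `AffineIsotopy.toMat` of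
`AffineAmbientIsotopy.lean` (not in the import closure of this file). [folklore] -/
def toMat : (𝔼 3 →L[ℝ] 𝔼 3) →L[ℝ] 𝕄 :=
  LinearMap.toContinuousLinearMap
    { toFun := fun f ↦ (Matrix.toEuclideanCLM (n := Fin 3) (𝕜 := ℝ)).symm f
      map_add' := fun f g ↦ map_add _ f g
      map_smul' := fun c f ↦ map_smul _ c f }

/-- `toMat` is the inverse of `matCLM`, pointwise. [folklore] -/
theorem toMat_apply (f : 𝔼 3 →L[ℝ] 𝔼 3) :
    toMat f = (Matrix.toEuclideanCLM (n := Fin 3) (𝕜 := ℝ)).symm f := rfl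

/-- `matCLM (toMat f) = f`. [folklore] -/
@[simp] theorem matCLM_toMat (f : 𝔼 3 →L[ℝ] 𝔼 3) : matCLM (toMat f) = f :=
  (Matrix.toEuclideanCLM (n := Fin 3) (𝕜 := ℝ)).apply_symm_apply f

/-- `toMat (matCLM N) = N`. [folklore] -/
@[simp] theorem toMat_matCLM (N : 𝕄) : toMat (matCLM N) = N :=
  (Matrix.toEuclideanCLM (n := Fin 3) (𝕜 := ℝ)).symm_apply_apply N

/-- `toMat` is multiplicative. [folklore] -/
theorem toMat_mul (f g : 𝔼 3 →L[ℝ] 𝔼 3) : toMat (f * g) = toMat f * toMat g := by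
  rw [toMat_apply, toMat_apply, toMat_apply, map_mul]

/-- `toMat 1 = 1`. [folklore] -/
@[simp] theorem toMat_one : toMat (1 : 𝔼 3 →L[ℝ] 𝔼 3) = 1 := by
  rw [toMat_apply, map_one]

/-- Entries of the matrix of a smooth operator family are smooth. [folklore] -/
theorem contDiff_toMat_apply {f : ℝ → (𝔼 3 →L[ℝ] 𝔼 3)} (hf : ContDiff ℝ ∞ f) (i j : Fin 3) :
    ContDiff ℝ ∞ fun θ ↦ toMat (f θ) i j :=
  contDiff_entry (toMat.contDiff.comp hf) i j

/-- **The determinant of `matCLM N` is `det N`.** [folklore] -/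
theorem det_matCLM (N : 𝕄) : LinearMap.det (matCLM N : 𝔼 3 →ₗ[ℝ] 𝔼 3) = N.det := by
  rw [matCLM, Matrix.coe_toEuclideanCLM_eq_toEuclideanLin, Matrix.toEuclideanLin_eq_toLin_orthonormal,
    LinearMap.det_toLin]

/-- The determinant of an operator is the determinant of its matrix. [folklore] -/
theorem det_toMat (f : 𝔼 3 →L[ℝ] 𝔼 3) : (toMat f).det = LinearMap.det (f : 𝔼 3 →ₗ[ℝ] 𝔼 3) := by
  conv_rhs => rw [← matCLM_toMat f]
  rw [det_matCLM]

end ToMat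

/-! ### Smooth matrix paths to a matrix of positive determinant -/

section PosDetPath

/-- Local notation: `𝕄` is the algebra of real `3 × 3` matrices. -/
local notation "𝕄" => Matrix (Fin 3) (Fin 3) ℝ

/-- The scalar `1 + ρ(θ) (s - 1) = (1 - ρ) + ρ s` is positive for `s > 0`. [folklore] -/
theorem one_add_smoothTransition_mul_pos {s : ℝ} (hs : 0 < s) (θ : ℝ) :
    0 < 1 + Real.smoothTransition θ * (s - 1) := by
  have h0 := Real.smoothTransition.nonneg θ
  have h1 := Real.smoothTransition.le_one θ
  have h2 : 0 ≤ Real.smoothTransition θ * s := mul_nonneg h0 hs.le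
  have h3 : Real.smoothTransition θ * (s - 1) = Real.smoothTransition θ * s - Real.smoothTransition θ := by
    ring
  rcases eq_or_lt_of_le h1 with h | h
  · rw [h]; linarith
  · linarith

/-- A smooth matrix path from `1` to the positive scalar matrix `s • 1` (`s > 0`): the scalar
path `θ ↦ (1 + ρ(θ) (s - 1)) • 1`. [folklore] -/
def SmoothMatrixPath.scalar {s : ℝ} (hs : 0 < s) : SmoothMatrixPath (s • (1 : 𝕄)) where
  toFun θ := (1 + Real.smoothTransition θ * (s - 1)) • (1 : 𝕄)
  inv θ := (1 + Real.smoothTransition θ * (s - 1))⁻¹ • (1 : 𝕄)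
  contDiff_apply i j := by
    simp only [Matrix.smul_apply, smul_eq_mul]
    exact (contDiff_const.add (Real.smoothTransition.contDiff.mul contDiff_const)).mul contDiff_const
  contDiff_inv_apply i j := by
    simp only [Matrix.smul_apply, smul_eq_mul]
    exact ((contDiff_const.add (Real.smoothTransition.contDiff.mul contDiff_const)).inv
      fun θ ↦ (one_add_smoothTransition_mul_pos hs θ).ne').mul contDiff_const
  mul_inv θ := by
    rw [smul_mul_smul_comm, mul_inv_cancel₀ (one_add_smoothTransition_mul_pos hs θ).ne', Matrix.mul_one,
      one_smul]
  inv_mul θ := by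
    rw [smul_mul_smul_comm, inv_mul_cancel₀ (one_add_smoothTransition_mul_pos hs θ).ne', Matrix.mul_one,
      one_smul]
  eq_one θ hθ := by rw [Real.smoothTransition.zero_of_nonpos hθ]; simp
  eq_self θ hθ := by rw [Real.smoothTransition.one_of_one_le hθ]; congr 1; ring

/-- **Every real `3 × 3` matrix of positive determinant is the end of a smooth matrix path from `1`**
(`GL⁺(3, ℝ)` is connected): `M = (d^{1/3} • 1) · (d^{-1/3} M)` with `d = det M`, a positive scalar
path times a path in `SL(3, ℝ)` (`nonempty_smoothMatrixPath_of_det_eq_one`). [folklore] -/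
theorem nonempty_smoothMatrixPath_of_det_pos (M : 𝕄) (hM : 0 < M.det) : Nonempty (SmoothMatrixPath M) := by
  set s : ℝ := M.det ^ ((1 : ℝ) / 3) with hs
  have hs0 : 0 < s := Real.rpow_pos_of_pos hM _
  have hs3 : s ^ 3 = M.det := by
    rw [hs, ← Real.rpow_natCast, ← Real.rpow_mul hM.le]
    norm_num
  have hdet : (s⁻¹ • M).det = 1 := by
    rw [Matrix.det_smul, Fintype.card_fin, inv_pow, hs3, inv_mul_cancel₀ hM.ne']
  obtain ⟨δ⟩ := nonempty_smoothMatrixPath_of_det_eq_one _ hdet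
  refine ⟨((SmoothMatrixPath.scalar hs0).mul δ).cast ?_⟩
  rw [smul_mul_assoc, Matrix.one_mul, smul_smul, mul_inv_cancel₀ hs0.ne', one_smul]

end PosDetPath

/-! ### Scaled products of inverse operators -/

/-- `(a P) (b P') = 1` for `P P' = 1` and `a b = 1`. [folklore] -/
theorem smul_mul_smul_eq_one {a b : ℝ} (hab : a * b = 1) {P P' : 𝔼 3 →L[ℝ] 𝔼 3} (h : P * P' = 1) :
    (a • P) * (b • P') = 1 := by
  refine ContinuousLinearMap.ext fun v ↦ ?_
  show a • P (b • P' v) = v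
  rw [map_smul, smul_smul, hab, one_smul]
  show (P * P') v = v
  rw [h]
  rfl

/-! ### Gompf tubes of two framing paths differ by a linear reframing, up to `1`-jet -/

section TwoPaths

variable (A : Matrix.SpecialLinearGroup (Fin 3) ℤ) (γ₀ γ₁ : SmoothMatrixPath (slRealMatrix A))

/-- **The comparison loop** `u ↦ κ · γ₀(2 angA u)⁻¹ γ₁(2 angA u)` (`κ = ε₁/ε₀` the ratio of the
tube radii) of two framing paths: the `1`-jet along the zero section of the transition map from the
Gompf tube of `γ₁` to the Gompf tube of `γ₀`. [cite: GompfAGT2010, §4 ¶2] -/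
def compLoop : OpLoop where
  toFun u := radiusRatio A γ₀ γ₁ • moveCLM γ₀ γ₁ u
  inv u := (radiusRatio A γ₀ γ₁)⁻¹ • moveCLM γ₁ γ₀ u
  contMDiff_toFun := (contDiff_const_smul (radiusRatio A γ₀ γ₁)).comp_contMDiff (contMDiff_moveCLM γ₀ γ₁)
  contMDiff_inv := (contDiff_const_smul (radiusRatio A γ₀ γ₁)⁻¹).comp_contMDiff (contMDiff_moveCLM γ₁ γ₀)
  mul_inv u := by
    refine smul_mul_smul_eq_one (mul_inv_cancel₀ (radiusRatio_pos A γ₀ γ₁).ne') ?_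
    rw [moveCLM, moveCLM, moveOp, moveOp, ← matCLM_mul, Matrix.mul_assoc, ← Matrix.mul_assoc (γ₁.toFun _),
      γ₁.mul_inv, Matrix.one_mul, γ₀.inv_mul, matCLM_one]
  inv_mul u := by
    refine smul_mul_smul_eq_one (inv_mul_cancel₀ (radiusRatio_pos A γ₀ γ₁).ne') ?_
    rw [moveCLM, moveCLM, moveOp, moveOp, ← matCLM_mul, Matrix.mul_assoc, ← Matrix.mul_assoc (γ₀.toFun _),
      γ₀.mul_inv, Matrix.one_mul, γ₁.inv_mul, matCLM_one]

/-- The comparison loop, pointwise (definitional). [folklore] -/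
theorem compLoop_apply (u : 𝕊 1) : (compLoop A γ₀ γ₁).toFun u = radiusRatio A γ₀ γ₁ • moveCLM γ₀ γ₁ u :=
  rfl

/-- **A uniform bound for the transition operators** over the (compact) circle. [folklore] -/
theorem exists_bound_moveCLM : ∃ K : ℝ, 0 < K ∧ ∀ u : 𝕊 1, ‖moveCLM γ₀ γ₁ u‖ ≤ K := by
  obtain ⟨K, hK⟩ := isCompact_univ.exists_bound_of_continuousOn
    ((contMDiff_moveCLM γ₀ γ₁).continuous.continuousOn (s := univ))
  exact ⟨max K 1, lt_of_lt_of_le one_pos (le_max_right _ _), fun u ↦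
    (hK u (mem_univ u)).trans (le_max_left _ _)⟩

/-- The bound of `exists_bound_moveCLM`. [folklore] -/
def moveBound : ℝ := (exists_bound_moveCLM A γ₀ γ₁).choose

/-- The bound is positive. [folklore] -/
theorem moveBound_pos : 0 < moveBound A γ₀ γ₁ := (exists_bound_moveCLM A γ₀ γ₁).choose_spec.1

/-- The bound bounds. [folklore] -/
theorem norm_moveCLM_le (u : 𝕊 1) : ‖moveCLM γ₀ γ₁ u‖ ≤ moveBound A γ₀ γ₁ :=
  (exists_bound_moveCLM A γ₀ γ₁).choose_spec.2 u

/-- **The comparison radius** `R = 1 / (κ K + 1)`: for `‖w‖ < R` the comparison fibre maps are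
defined by the formula `sh₀⁻¹ (κ P_u (sh₀ w))`. [folklore] -/
def compRadius : ℝ := 1 / (radiusRatio A γ₀ γ₁ * moveBound A γ₀ γ₁ + 1)

/-- The comparison radius is positive. [folklore] -/
theorem compRadius_pos : 0 < compRadius A γ₀ γ₁ :=
  div_pos one_pos (by have := mul_pos (radiusRatio_pos A γ₀ γ₁) (moveBound_pos A γ₀ γ₁); linarith)

/-- For `‖w‖ < R`, `κ P_u (sh₀ w)` lies in the ball `B(0, ε₀)` (the target of `sh₀`). [folklore] -/
theorem smul_moveCLM_shrink_mem_ball (u : 𝕊 1) {w : 𝔼 3} (hw : ‖w‖ < compRadius A γ₀ γ₁) :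
    radiusRatio A γ₀ γ₁ • moveCLM γ₀ γ₁ u ((twistA A γ₀).shrink w) ∈ ball (0 : 𝔼 3) (twistA A γ₀).ε := by
  have hε := twistRadius_pos A γ₀
  have hκ := radiusRatio_pos A γ₀ γ₁
  have hK := moveBound_pos A γ₀ γ₁
  rw [mem_ball_zero_iff, norm_smul, Real.norm_of_nonneg hκ.le]
  have h1 : ‖(twistA A γ₀).shrink w‖ ≤ twistRadius A γ₀ * ‖w‖ := by
    show ‖univBall (0 : 𝔼 3) (twistRadius A γ₀) w‖ ≤ _
    rw [norm_univBall_zero hε]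
    have hs : 1 ≤ Real.sqrt (1 + ‖w‖ ^ 2) := by
      rw [Real.le_sqrt (by norm_num) (by positivity)]
      nlinarith [norm_nonneg w]
    exact div_le_self (by positivity) hs
  have h2 : ‖moveCLM γ₀ γ₁ u ((twistA A γ₀).shrink w)‖ ≤ moveBound A γ₀ γ₁ * (twistRadius A γ₀ * ‖w‖) :=
    ((moveCLM γ₀ γ₁ u).le_opNorm _).trans (mul_le_mul (norm_moveCLM_le A γ₀ γ₁ u) h1 (norm_nonneg _) hK.le)
  have h3 : radiusRatio A γ₀ γ₁ * moveBound A γ₀ γ₁ * ‖w‖ < 1 := by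
    have hlt : ‖w‖ * (radiusRatio A γ₀ γ₁ * moveBound A γ₀ γ₁ + 1) < 1 := by
      rw [compRadius, lt_div_iff₀ (by positivity)] at hw
      linarith
    nlinarith [norm_nonneg w]
  calc radiusRatio A γ₀ γ₁ * ‖moveCLM γ₀ γ₁ u ((twistA A γ₀).shrink w)‖
      ≤ radiusRatio A γ₀ γ₁ * (moveBound A γ₀ γ₁ * (twistRadius A γ₀ * ‖w‖)) :=
        mul_le_mul_of_nonneg_left h2 hκ.le
    _ = (radiusRatio A γ₀ γ₁ * moveBound A γ₀ γ₁ * ‖w‖) * twistRadius A γ₀ := by ring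
    _ < 1 * twistRadius A γ₀ := mul_lt_mul_of_pos_right h3 hε
    _ = (twistA A γ₀).ε := one_mul _

/-- **The comparison fibre maps** `F_u (w) = sh₀⁻¹ (κ P_u (sh₀ w))`. [folklore] -/
def compFibre (u : 𝕊 1) (w : 𝔼 3) : 𝔼 3 :=
  (twistA A γ₀).shrink.symm (radiusRatio A γ₀ γ₁ • moveCLM γ₀ γ₁ u ((twistA A γ₀).shrink w))

/-- On `B(0, R)`, `sh₀ (F_u w) = κ P_u (sh₀ w)`. [folklore] -/
theorem shrink_compFibre (u : 𝕊 1) {w : 𝔼 3} (hw : ‖w‖ < compRadius A γ₀ γ₁) :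
    (twistA A γ₀).shrink (compFibre A γ₀ γ₁ u w) =
      radiusRatio A γ₀ γ₁ • moveCLM γ₀ γ₁ u ((twistA A γ₀).shrink w) :=
  (twistA A γ₀).shrink_apply_symm_apply (smul_moveCLM_shrink_mem_ball A γ₀ γ₁ u hw)

/-- The comparison fibre maps fix the origin. [folklore] -/
@[simp] theorem compFibre_zero (u : 𝕊 1) : compFibre A γ₀ γ₁ u 0 = 0 := by
  rw [compFibre, TubeTwist.shrink_zero, map_zero, smul_zero]
  exact univBall_symm_apply_center _ _

/-- **Over the first piece the two Gompf tubes agree at fibre points related by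
`sh₀ w' = κ P_u (sh₀ w)`**: `texp_{γ₀} s w' = texp_{γ₁} s w`, `s = angA u`, `u ≠ ptA` (pointwise
form of `texp_twistA_moveFibre` of `GompfTubeMoves.lean`, which is the case `w' = moveFibre u w`
under the closeness hypothesis `TubeClose`; same one-line computation). [folklore] -/
theorem texp_twistA_eq_of_shrink_eq {u : 𝕊 1} (hu : u ≠ ptA) {w w' : 𝔼 3}
    (h : (twistA A γ₀).shrink w' = radiusRatio A γ₀ γ₁ • moveCLM γ₀ γ₁ u ((twistA A γ₀).shrink w)) :
    (twistA A γ₀).texp (angAPt u) w' = (twistA A γ₁).texp (angAPt u) w := by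
  simp only [TubeTwist.texp]
  show expT (mulVecE (γ₀.toFun (2 * _)) _) = expT (mulVecE (γ₁.toFun (2 * _)) _)
  rw [h, shrink_eq_smul A γ₀ γ₁, ← ContinuousLinearMap.map_smul_of_tower, moveCLM, coe_angAPt hu,
    mulVecE_moveOp]

/-- **At `ptA` (second piece, level `t = 1`) the tubes agree** at such fibre points (pointwise
form of `texp_twistB_moveFibre_ptA` of `GompfTubeMoves.lean`). [folklore] -/
theorem texp_twistB_ptA_eq_of_shrink_eq {w w' : 𝔼 3}
    (h : (twistA A γ₀).shrink w' = radiusRatio A γ₀ γ₁ • moveCLM γ₀ γ₁ ptA ((twistA A γ₀).shrink w)) :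
    (twistB A γ₀).texp (angBPt ptA) w' = (twistB A γ₁).texp (angBPt ptA) w := by
  have h1 : ((angBPt ptA : ℝ)) ≤ 1 := coe_angBPt_ptA.le
  rw [texp_twistB_of_le A γ₀ h1, texp_twistB_of_le A γ₁ h1, h, shrink_eq_smul A γ₀ γ₁, moveCLM_ptA]
  rfl

/-- **The Gompf tube of `γ₁` is the Gompf tube of `γ₀` at fibre points related by
`sh₀ w' = κ P_u (sh₀ w)`**: `ν_{γ₁} (u, w) = ν_{γ₀} (u, w')` (pointwise form of
`secNbhdFun_eq_moveFibre` of `GompfTubeMoves.lean`, freed from the closeness hypothesis). [folklore] -/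
theorem secNbhdFun_eq_of_shrink_eq (u : 𝕊 1) {w w' : 𝔼 3}
    (h : (twistA A γ₀).shrink w' = radiusRatio A γ₀ γ₁ • moveCLM γ₀ γ₁ u ((twistA A γ₀).shrink w)) :
    secNbhdFun A γ₁ (u, w) = secNbhdFun A γ₀ (u, w') := by
  by_cases hu : u = ptA
  · subst hu
    rw [secNbhdFun_of_ne_ptB A γ₁ (show ((ptA, w) : (𝕊 1) × 𝔼 3).1 ≠ ptB from ptA_ne_ptB),
      secNbhdFun_of_ne_ptB A γ₀ (show ((ptA, w') : (𝕊 1) × 𝔼 3).1 ≠ ptB from ptA_ne_ptB),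
      TubeTwist.tubeB_apply, TubeTwist.tubeB_apply]
    dsimp only
    rw [texp_twistB_ptA_eq_of_shrink_eq A γ₀ γ₁ h]
  · rw [secNbhdFun_of_ne A γ₁ (show ((u, w) : (𝕊 1) × 𝔼 3).1 ≠ ptA from hu),
      secNbhdFun_of_ne A γ₀ (show ((u, w') : (𝕊 1) × 𝔼 3).1 ≠ ptA from hu),
      TubeTwist.tubeA_apply, TubeTwist.tubeA_apply]
    dsimp only
    rw [texp_twistA_eq_of_shrink_eq A γ₀ γ₁ hu h]

/-- **The Gompf tube of `γ₁` is the Gompf tube of `γ₀` reparametrised by the comparison fibre maps**: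
`ν_{γ₁} (u, w) = ν_{γ₀} (u, F_u w)` for `‖w‖ < R`. [folklore] -/
theorem secNbhdFun_eq_compFibre (u : 𝕊 1) {w : 𝔼 3} (hw : ‖w‖ < compRadius A γ₀ γ₁) :
    secNbhdFun A γ₁ (u, w) = secNbhdFun A γ₀ (u, compFibre A γ₀ γ₁ u w) :=
  secNbhdFun_eq_of_shrink_eq A γ₀ γ₁ u (shrink_compFibre A γ₀ γ₁ u hw)

/-- **The comparison fibre maps composed with the inverse comparison loop** (the fibre maps of the
jet lemma): `g_u = Q_u⁻¹ ∘ F_u`. [folklore] -/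
def compJet (u : 𝕊 1) (w : 𝔼 3) : 𝔼 3 := (compLoop A γ₀ γ₁).inv u (compFibre A γ₀ γ₁ u w)

/-- The jet fibre maps fix the origin. [folklore] -/
theorem compJet_zero (u : 𝕊 1) : compJet A γ₀ γ₁ u 0 = 0 := by
  rw [compJet, compFibre_zero, map_zero]

/-- **The lifted jet fibre maps are smooth on `ℝ × B(0, R)`.** [folklore] -/
theorem contDiffOn_angLift_compJet :
    ContDiffOn ℝ ∞ (angLift (compJet A γ₀ γ₁)) (univ ×ˢ ball 0 (compRadius A γ₀ γ₁)) := by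
  have hε := twistRadius_pos A γ₀
  -- the loops read through `circlePt` are smooth maps `ℝ → CLM`
  have hP : ContDiff ℝ ∞ fun θ : ℝ ↦ moveCLM γ₀ γ₁ (circlePt θ) :=
    contMDiff_iff_contDiff.1 ((contMDiff_moveCLM γ₀ γ₁).comp contMDiff_circlePt)
  have hQ : ContDiff ℝ ∞ fun θ : ℝ ↦ (compLoop A γ₀ γ₁).inv (circlePt θ) :=
    contMDiff_iff_contDiff.1 ((compLoop A γ₀ γ₁).contMDiff_inv.comp contMDiff_circlePt)
  -- `(θ, w) ↦ κ P (sh₀ w)`, into the ball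
  have h1 : ContDiff ℝ ∞ fun p : ℝ × 𝔼 3 ↦
      radiusRatio A γ₀ γ₁ • moveCLM γ₀ γ₁ (circlePt p.1) ((twistA A γ₀).shrink p.2) :=
    ((hP.comp contDiff_fst).clm_apply ((twistA A γ₀).contDiff_shrink.comp contDiff_snd)).const_smul _
  have h2 : ContDiffOn ℝ ∞ (fun p : ℝ × 𝔼 3 ↦ (twistA A γ₀).shrink.symm
      (radiusRatio A γ₀ γ₁ • moveCLM γ₀ γ₁ (circlePt p.1) ((twistA A γ₀).shrink p.2)))
      (univ ×ˢ ball 0 (compRadius A γ₀ γ₁)) :=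
    (twistA A γ₀).contDiffOn_shrink_symm.comp h1.contDiffOn fun p hp ↦
      smul_moveCLM_shrink_mem_ball A γ₀ γ₁ _ (mem_ball_zero_iff.1 hp.2)
  exact (hQ.comp contDiff_fst).contDiffOn.clm_apply h2

/-- **The derivative of the comparison fibre map at the origin is the comparison operator**:
`D F_u (0) = κ P_u` (chain rule with `D sh₀ (0) = ε₀ id`, `D sh₀⁻¹ (0) = ε₀⁻¹ id`). [folklore] -/
theorem hasFDerivAt_compFibre_zero (u : 𝕊 1) :
    HasFDerivAt (compFibre A γ₀ γ₁ u) (radiusRatio A γ₀ γ₁ • moveCLM γ₀ γ₁ u) 0 := by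
  have hε := twistRadius_pos A γ₀
  have hsh : HasFDerivAt (twistA A γ₀).shrink
      (twistRadius A γ₀ • ContinuousLinearMap.id ℝ (𝔼 3)) 0 := hasFDerivAt_univBall_zero hε
  have hlin : HasFDerivAt (⇑(radiusRatio A γ₀ γ₁ • moveCLM γ₀ γ₁ u))
      (radiusRatio A γ₀ γ₁ • moveCLM γ₀ γ₁ u) ((twistA A γ₀).shrink 0) :=
    (radiusRatio A γ₀ γ₁ • moveCLM γ₀ γ₁ u).hasFDerivAt
  have h12 := hlin.comp 0 hsh
  have hsymm : HasFDerivAt (twistA A γ₀).shrink.symm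
      ((twistRadius A γ₀)⁻¹ • ContinuousLinearMap.id ℝ (𝔼 3))
      (radiusRatio A γ₀ γ₁ • moveCLM γ₀ γ₁ u ((twistA A γ₀).shrink 0)) := by
    rw [TubeTwist.shrink_zero, map_zero, smul_zero]
    exact hasFDerivAt_univBall_symm_zero hε
  have h := hsymm.comp 0 h12
  have hfun : compFibre A γ₀ γ₁ u = (twistA A γ₀).shrink.symm ∘
      ⇑(radiusRatio A γ₀ γ₁ • moveCLM γ₀ γ₁ u) ∘ (twistA A γ₀).shrink := rfl
  rw [hfun]
  refine h.congr_fderiv (ContinuousLinearMap.ext fun v ↦ ?_)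
  show (twistRadius A γ₀)⁻¹ • (radiusRatio A γ₀ γ₁ • moveCLM γ₀ γ₁ u (twistRadius A γ₀ • v)) =
    radiusRatio A γ₀ γ₁ • moveCLM γ₀ γ₁ u v
  rw [map_smul, smul_smul, smul_smul, show (twistRadius A γ₀)⁻¹ * radiusRatio A γ₀ γ₁ * twistRadius A γ₀ =
    radiusRatio A γ₀ γ₁ by field_simp]

/-- The jet fibre maps have derivative `id` at the origin. [folklore] -/
theorem fderiv_compJet_zero (u : 𝕊 1) : fderiv ℝ (compJet A γ₀ γ₁ u) 0 = ContinuousLinearMap.id ℝ (𝔼 3) := by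
  have h := ((compLoop A γ₀ γ₁).inv u).hasFDerivAt.comp 0 (hasFDerivAt_compFibre_zero A γ₀ γ₁ u)
  rw [show compJet A γ₀ γ₁ u = ⇑((compLoop A γ₀ γ₁).inv u) ∘ compFibre A γ₀ γ₁ u from rfl, h.fderiv]
  exact (compLoop A γ₀ γ₁).inv_mul u

/-- The jet lemma for tubes around propositionally equal circles. [cite: GompfStipsiczGSM1999, §5.2] -/
theorem CircleNbhd.nonempty_diffeomorph_surgered_of_jet_of_eq {X : Type u} [TopologicalSpace X]
    [ChartedSpace (𝔼 4) X] [T2Space X] [IsManifold (𝓡 4) ∞ X] {c c' : 𝕊 1 → X}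
    (ν : CircleNbhd (𝓡 4) c) (ν' : CircleNbhd (𝓡 4) c') (hc : c = c')
    (g : 𝕊 1 → 𝔼 3 → 𝔼 3) {R : ℝ} (hR : 0 < R)
    (hg : ContDiffOn ℝ ∞ (angLift g) (univ ×ˢ ball 0 R)) (h0 : ∀ u, g u 0 = 0)
    (h1 : ∀ u, fderiv ℝ (g u) 0 = ContinuousLinearMap.id ℝ (𝔼 3))
    (hνν' : ∀ u (w : 𝔼 3), ‖w‖ < R → ν'.toFun (u, w) = ν.toFun (u, g u w)) :
    Nonempty (ν.Surgered ≃ₘ⟮𝓡 4, 𝓡 4⟯ ν'.Surgered) := by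
  subst hc
  exact ν.nonempty_diffeomorph_surgered_of_jet ν' g hR hg h0 h1 hνν'

/-- **The Gompf sphere of `γ₁` is the surgery along the Gompf tube of `γ₀` reframed by the
comparison loop**: `gompfSphere A γ₁ ≅ ((sectionCircleNbhd A γ₀).linTwist Q).Surgered` (jet lemma). [cite: GompfAGT2010, §4 ¶2] [cite: GompfStipsiczGSM1999, §5.2] -/
theorem nonempty_diffeomorph_linTwist_compLoop_gompfSphere :
    Nonempty (((sectionCircleNbhd A γ₀).linTwist (compLoop A γ₀ γ₁)).Surgered ≃ₘ⟮𝓡 4, 𝓡 4⟯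
      gompfSphere A γ₁) := by
  refine CircleNbhd.nonempty_diffeomorph_surgered_of_jet_of_eq
    ((sectionCircleNbhd A γ₀).linTwist (compLoop A γ₀ γ₁)) (sectionCircleNbhd A γ₁)
    (sectionCircle_eq A γ₀ γ₁) (compJet A γ₀ γ₁) (compRadius_pos A γ₀ γ₁)
    (contDiffOn_angLift_compJet A γ₀ γ₁) (compJet_zero A γ₀ γ₁) (fderiv_compJet_zero A γ₀ γ₁)
    fun u w hw ↦ ?_
  rw [CircleNbhd.linTwist_apply, compJet, OpLoop.apply_inv_apply]
  exact secNbhdFun_eq_compFibre A γ₀ γ₁ u hw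

end TwoPaths

/-- `circlePt 1 = ptA` (`circlePt_add_one` at `0`; cf. `Knot.TubularNbhd.circlePt_one` of
`DehnSurgeryFramingProofs.lean`, the same point written `circlePoint 0`, not imported here). [folklore] -/
theorem circlePt_one_eq_ptA : circlePt 1 = ptA := by
  have h := circlePt_add_one 0
  rw [zero_add] at h
  exact h

/-! ### Loops of operators read through a reparametrised angle -/

section SeamArg

/-- **The reparametrised angle of the family**: `μ_t (a) = (1 - τ(t)) τ(2a) + τ(t) a` (`τ` Mathlib's
smooth transition `Real.smoothTransition`, so that the interpolation parameter `τ(t)` lies in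
`[0, 1]` for every real `t`, is `0` at `t = 0` and `1` at `t = 1`): at `t = 0` the double-speed
transition `τ(2a)` of the Gompf tube, at `t = 1` the identity. [folklore] -/
def famArg (t a : ℝ) : ℝ :=
  (1 - Real.smoothTransition t) * Real.smoothTransition (2 * a) + Real.smoothTransition t * a

/-- The same angle read through `angB = angA (+ 1)`:
`μ̃_t (b) = (1 - τ(t)) τ(2(b - 1)) + τ(t) (b - 1)`. [folklore] -/
def famArgB (t b : ℝ) : ℝ :=
  (1 - Real.smoothTransition t) * Real.smoothTransition (2 * (b - 1)) + Real.smoothTransition t * (b - 1)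

/-- `μ_t` is smooth in the angle. [folklore] -/
theorem contDiff_famArg (t : ℝ) : ContDiff ℝ ∞ (famArg t) :=
  (contDiff_const.mul (Real.smoothTransition.contDiff.comp (contDiff_const.mul contDiff_id))).add
    (contDiff_const.mul contDiff_id)

/-- `μ̃_t` is smooth in the angle. [folklore] -/
theorem contDiff_famArgB (t : ℝ) : ContDiff ℝ ∞ (famArgB t) :=
  (contDiff_const.mul (Real.smoothTransition.contDiff.comp
    (contDiff_const.mul (contDiff_id.sub contDiff_const)))).add
    (contDiff_const.mul (contDiff_id.sub contDiff_const))

/-- `(t, a) ↦ μ_t (a)` is continuous. [folklore] -/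
theorem continuous_famArg : Continuous fun p : ℝ × ℝ ↦ famArg p.1 p.2 := by
  unfold famArg
  have hc : Continuous fun p : ℝ × ℝ ↦ Real.smoothTransition p.1 :=
    Real.smoothTransition.continuous.comp continuous_fst
  exact ((continuous_const.sub hc).mul (Real.smoothTransition.continuous.comp
    (continuous_const.mul continuous_snd))).add (hc.mul continuous_snd)

/-- `(t, b) ↦ μ̃_t (b)` is continuous. [folklore] -/
theorem continuous_famArgB : Continuous fun p : ℝ × ℝ ↦ famArgB p.1 p.2 := by
  unfold famArgB
  have hc : Continuous fun p : ℝ × ℝ ↦ Real.smoothTransition p.1 :=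
    Real.smoothTransition.continuous.comp continuous_fst
  exact ((continuous_const.sub hc).mul (Real.smoothTransition.continuous.comp
    (continuous_const.mul (continuous_snd.sub continuous_const)))).add
    (hc.mul (continuous_snd.sub continuous_const))

/-- `angA ptB = 1/2`. [folklore] -/
theorem angA_ptB : angA ptB = 1 / 2 :=
  angA_circlePt ⟨by norm_num, by norm_num⟩

/-- **The two readings define the same point of the circle**:
`circlePt (μ_t (angA u)) = circlePt (μ̃_t (angB u))` for every `u` (they agree or differ by `1`). [folklore] -/
theorem circlePt_famArg_angA_eq (t : ℝ) (u : 𝕊 1) :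
    circlePt (famArg t (angA u)) = circlePt (famArgB t (angB u)) := by
  by_cases hA : u = ptA
  · subst hA
    have h1 : famArg t 1 = 1 := by
      rw [famArg, mul_one, Real.smoothTransition.one_of_one_le (by norm_num : (1 : ℝ) ≤ 2)]
      ring
    have h2 : famArgB t 1 = 0 := by
      rw [famArgB, sub_self, mul_zero, Real.smoothTransition.zero]
      ring
    rw [angA_ptA, angB_ptA, h1, h2, circlePt_one_eq_ptA]
    rfl
  by_cases hB : u = ptB
  · subst hB
    have h1 : famArg t (1 / 2) = (1 - Real.smoothTransition t) + Real.smoothTransition t * (1 / 2) := by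
      rw [famArg, show (2 : ℝ) * (1 / 2) = 1 by norm_num, Real.smoothTransition.one]
      ring
    have h2 : famArgB t (3 / 2) = (1 - Real.smoothTransition t) + Real.smoothTransition t * (1 / 2) := by
      rw [famArgB, show (2 : ℝ) * (3 / 2 - 1) = 1 by norm_num, Real.smoothTransition.one]
      ring
    rw [angA_ptB, angB_ptB, h1, h2]
  rcases angB_eq_of_ne hA hB with ⟨hlt, h1⟩ | ⟨hgt, h0⟩
  · rw [h1, famArg, famArgB, add_sub_cancel_right]
  · have h2 : famArgB t (angA u) + 1 = famArg t (angA u) := by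
      rw [famArg, famArgB, Real.smoothTransition.one_of_one_le (by linarith : (1 : ℝ) ≤ 2 * angA u),
        Real.smoothTransition.zero_of_nonpos (by linarith [(angA_mem_Ioc u).2] : 2 * (angA u - 1) ≤ 0)]
      ring
    rw [h0, ← h2, circlePt_add_one]

variable {V : Type*} [NormedAddCommGroup V] [NormedSpace ℝ V] {f : 𝕊 1 → V}
  (hf : ContMDiff (𝓡 1) 𝓘(ℝ, V) ∞ f)
include hf

/-- **A smooth function of the circle read through the reparametrised angle is smooth**:
`u ↦ f (circlePt (μ_t (angA u)))` (through `angA` off `ptA`, through `angB` off `ptB`). [folklore] -/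
theorem contMDiff_comp_circlePt_famArg (t : ℝ) :
    ContMDiff (𝓡 1) 𝓘(ℝ, V) ∞ fun u : 𝕊 1 ↦ f (circlePt (famArg t (angA u))) := by
  have hF : ContDiff ℝ ∞ fun a : ℝ ↦ f (circlePt (famArg t a)) :=
    contMDiff_iff_contDiff.1 ((hf.comp contMDiff_circlePt).comp (contDiff_famArg t).contMDiff)
  have hFB : ContDiff ℝ ∞ fun b : ℝ ↦ f (circlePt (famArgB t b)) :=
    contMDiff_iff_contDiff.1 ((hf.comp contMDiff_circlePt).comp (contDiff_famArgB t).contMDiff)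
  intro u
  rcases ne_ptA_or_ne_ptB u with hA | hB
  · exact hF.contDiffAt.comp_contMDiffAt (contMDiffAt_angA hA)
  · have heq : (fun u : 𝕊 1 ↦ f (circlePt (famArg t (angA u)))) =
        fun u ↦ f (circlePt (famArgB t (angB u))) :=
      funext fun v ↦ by rw [circlePt_famArg_angA_eq]
    rw [heq]
    exact hFB.contDiffAt.comp_contMDiffAt (contMDiffAt_angB hB)

/-- **Joint continuity in `(t, u)`** of `f (circlePt (μ_t (angA u)))`. [folklore] -/
theorem continuous_comp_circlePt_famArg :
    Continuous fun p : ℝ × (𝕊 1) ↦ f (circlePt (famArg p.1 (angA p.2))) := by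
  have hc := hf.continuous.comp continuous_circlePt
  refine continuous_iff_continuousAt.2 fun p ↦ ?_
  rcases ne_ptA_or_ne_ptB p.2 with hA | hB
  · -- (elaborated without expected type: unifying a `famArg`-headed composite against the goal
    -- before the inner map is known makes the unifier unfold `Real.smoothTransition`)
    have h2 : ContinuousAt (fun q : ℝ × (𝕊 1) ↦ (q.1, angA q.2)) p :=
      continuousAt_fst.prodMk ((contMDiffAt_angA hA).continuousAt.comp continuousAt_snd)
    have h1 := continuous_famArg.continuousAt.comp h2
    exact hc.continuousAt.comp h1
  · have heq : (fun q : ℝ × (𝕊 1) ↦ f (circlePt (famArg q.1 (angA q.2)))) =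
        fun q ↦ f (circlePt (famArgB q.1 (angB q.2))) :=
      funext fun q ↦ by rw [circlePt_famArg_angA_eq]
    rw [heq]
    have h2 : ContinuousAt (fun q : ℝ × (𝕊 1) ↦ (q.1, angB q.2)) p :=
      continuousAt_fst.prodMk ((contMDiffAt_angB hB).continuousAt.comp continuousAt_snd)
    have h1 := continuous_famArgB.continuousAt.comp h2
    exact hc.continuousAt.comp h1

end SeamArg

/-! ### Realising a positively oriented loop by a framing path -/

section Realise

/-- Local notation: `𝕄` is the algebra of real `3 × 3` matrices. -/
local notation "𝕄" => Matrix (Fin 3) (Fin 3) ℝ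

variable (L : OpLoop)


/-- A smooth loop of operators read through `circlePt` is a smooth function on the line. [folklore] -/
theorem OpLoop.contDiff_toFun_circlePt : ContDiff ℝ ∞ fun θ : ℝ ↦ L.toFun (circlePt θ) :=
  contMDiff_iff_contDiff.1 (L.contMDiff_toFun.comp contMDiff_circlePt)

/-- The inverse loop read through `circlePt` is smooth. [folklore] -/
theorem OpLoop.contDiff_inv_circlePt : ContDiff ℝ ∞ fun θ : ℝ ↦ L.inv (circlePt θ) :=
  contMDiff_iff_contDiff.1 (L.contMDiff_inv.comp contMDiff_circlePt)

/-- **The matrix path of a loop**: `N(θ) = L(ptA)⁻¹ L(circlePt (τ θ))`, a smooth matrix path from `1`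
to `1` (`τ` the smooth transition: `τ = 0` for `θ ≤ 0`, `τ = 1` for `θ ≥ 1`, and `circlePt 1 = ptA`). [folklore] -/
def OpLoop.matrixPath : SmoothMatrixPath (1 : 𝕄) where
  toFun θ := toMat (L.inv ptA * L.toFun (circlePt (Real.smoothTransition θ)))
  inv θ := toMat (L.inv (circlePt (Real.smoothTransition θ)) * L.toFun ptA)
  contDiff_apply := contDiff_toMat_apply
    (contDiff_const.mul (L.contDiff_toFun_circlePt.comp Real.smoothTransition.contDiff))
  contDiff_inv_apply := contDiff_toMat_apply
    ((L.contDiff_inv_circlePt.comp Real.smoothTransition.contDiff).mul contDiff_const)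
  mul_inv θ := by
    rw [← toMat_mul, mul_assoc, ← mul_assoc (L.toFun _), L.mul_inv, one_mul, L.inv_mul, toMat_one]
  inv_mul θ := by
    rw [← toMat_mul, mul_assoc, ← mul_assoc (L.toFun ptA), L.mul_inv, one_mul, L.inv_mul, toMat_one]
  eq_one θ hθ := by
    rw [Real.smoothTransition.zero_of_nonpos hθ]
    show toMat (L.inv ptA * L.toFun ptA) = 1
    rw [L.inv_mul, toMat_one]
  eq_self θ hθ := by
    rw [Real.smoothTransition.one_of_one_le hθ, circlePt_one_eq_ptA, L.inv_mul, toMat_one]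

variable (A : Matrix.SpecialLinearGroup (Fin 3) ℤ) (γ₀ : SmoothMatrixPath (slRealMatrix A))

/-- **The framing path realising the loop `L`**: `γ_L = γ₀ · N`. [cite: GompfAGT2010, §4 ¶2] -/
def OpLoop.framingPath : SmoothMatrixPath (slRealMatrix A) := (γ₀.mul L.matrixPath).cast (Matrix.mul_one _)

/-- The transition operators from `γ₀` to `γ_L`: `γ₀(θ)⁻¹ γ_L(θ) = L(ptA)⁻¹ L(circlePt (τ θ))`. [folklore] -/
theorem moveOp_framingPath (θ : ℝ) :
    moveOp γ₀ (L.framingPath A γ₀) θ = L.inv ptA * L.toFun (circlePt (Real.smoothTransition θ)) := by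
  rw [moveOp]
  show matCLM (γ₀.inv θ * (γ₀.toFun θ * toMat (L.inv ptA * L.toFun (circlePt (Real.smoothTransition θ))))) = _
  rw [← Matrix.mul_assoc, γ₀.inv_mul, Matrix.one_mul, matCLM_toMat]

/-- The comparison loop of `γ₀`, `γ_L`: `Q_u = κ · L(ptA)⁻¹ L(circlePt (τ (2 angA u)))`. [folklore] -/
theorem compLoop_framingPath_apply (u : 𝕊 1) :
    (compLoop A γ₀ (L.framingPath A γ₀)).toFun u = radiusRatio A γ₀ (L.framingPath A γ₀) •
      (L.inv ptA * L.toFun (circlePt (Real.smoothTransition (2 * angA u)))) := by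
  rw [compLoop_apply, moveCLM, moveOp_framingPath]

/-- The scalar of the family: `c_t = (1 - τ(t)) κ + τ(t)`. [folklore] -/
def famScalar (t : ℝ) : ℝ :=
  (1 - Real.smoothTransition t) * radiusRatio A γ₀ (L.framingPath A γ₀) + Real.smoothTransition t

/-- The scalar of the family is positive. [folklore] -/
theorem famScalar_pos (t : ℝ) : 0 < famScalar L A γ₀ t := by
  have hκ := radiusRatio_pos A γ₀ (L.framingPath A γ₀)
  have hc0 := Real.smoothTransition.nonneg t
  have hc1 := Real.smoothTransition.le_one t
  have h1 : 0 ≤ (1 - Real.smoothTransition t) * radiusRatio A γ₀ (L.framingPath A γ₀) :=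
    mul_nonneg (by linarith) hκ.le
  rw [famScalar]
  rcases eq_or_lt_of_le hc0 with h | h
  · rw [← h]; linarith
  · linarith

/-- The scalar of the family is continuous. [folklore] -/
theorem continuous_famScalar : Continuous (famScalar L A γ₀) :=
  ((continuous_const.sub Real.smoothTransition.continuous).mul continuous_const).add
    Real.smoothTransition.continuous

variable (hL : 0 < LinearMap.det (L.toFun ptA : 𝔼 3 →ₗ[ℝ] 𝔼 3))
include hL

/-- `det L(ptA)⁻¹ > 0`. [folklore] -/
theorem det_toMat_inv_ptA_pos : 0 < (toMat (L.inv ptA)).det := by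
  rw [det_toMat]
  have h := congrArg (fun f : 𝔼 3 →L[ℝ] 𝔼 3 ↦ LinearMap.det (f : 𝔼 3 →ₗ[ℝ] 𝔼 3)) (L.mul_inv ptA)
  simp only [ContinuousLinearMap.toLinearMap_mul, map_mul, ContinuousLinearMap.one_def,
    ContinuousLinearMap.coe_id, LinearMap.det_id] at h
  have hne : LinearMap.det (L.inv ptA : 𝔼 3 →ₗ[ℝ] 𝔼 3) ≠ 0 := right_ne_zero_of_mul_eq_one h
  rcases hne.lt_or_gt with hneg | hpos
  · nlinarith
  · exact hpos

/-- A smooth matrix path from `1` to `L(ptA)⁻¹` (connectedness of `GL⁺(3, ℝ)`). [folklore] -/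
def basePath : SmoothMatrixPath (toMat (L.inv ptA)) :=
  Classical.choice (nonempty_smoothMatrixPath_of_det_pos _ (det_toMat_inv_ptA_pos L hL))

/-- **The connecting family of loops** `F_t (u) = c_t · C_t · L(circlePt (μ_t (angA u)))`:
`c_t` from `κ` to `1`, `C_t` from `L(ptA)⁻¹` to `1` in `GL⁺(3, ℝ)`, `μ_t` from `τ(2·)` to `id`. [folklore] -/
def famLoop (t : ℝ) : OpLoop where
  toFun u := famScalar L A γ₀ t • (matCLM ((basePath L hL).toFun (1 - t)) * L.toFun (circlePt (famArg t (angA u))))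
  inv u := (famScalar L A γ₀ t)⁻¹ •
    (L.inv (circlePt (famArg t (angA u))) * matCLM ((basePath L hL).inv (1 - t)))
  contMDiff_toFun := (contDiff_const_smul (famScalar L A γ₀ t)).comp_contMDiff
    ((contDiff_mul (𝔸 := 𝔼 3 →L[ℝ] 𝔼 3) (n := ∞)).comp_contMDiff
      (contMDiff_const.prodMk_space (contMDiff_comp_circlePt_famArg L.contMDiff_toFun t)))
  contMDiff_inv := (contDiff_const_smul (famScalar L A γ₀ t)⁻¹).comp_contMDiff
    ((contDiff_mul (𝔸 := 𝔼 3 →L[ℝ] 𝔼 3) (n := ∞)).comp_contMDiff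
      ((contMDiff_comp_circlePt_famArg L.contMDiff_inv t).prodMk_space contMDiff_const))
  mul_inv u := by
    refine smul_mul_smul_eq_one (mul_inv_cancel₀ (famScalar_pos L A γ₀ t).ne') ?_
    rw [mul_assoc, ← mul_assoc (L.toFun _), L.mul_inv, one_mul, ← matCLM_mul, (basePath L hL).mul_inv,
      matCLM_one]
  inv_mul u := by
    refine smul_mul_smul_eq_one (inv_mul_cancel₀ (famScalar_pos L A γ₀ t).ne') ?_
    rw [mul_assoc, ← mul_assoc (matCLM _), ← matCLM_mul, (basePath L hL).inv_mul, matCLM_one, one_mul,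
      L.inv_mul]

/-- The family, pointwise (definitional). [folklore] -/
theorem famLoop_toFun (t : ℝ) (u : 𝕊 1) : (famLoop L A γ₀ hL t).toFun u =
    famScalar L A γ₀ t • (matCLM ((basePath L hL).toFun (1 - t)) * L.toFun (circlePt (famArg t (angA u)))) :=
  rfl

/-- At `t = 0` the family is the comparison loop. [folklore] -/
theorem famLoop_zero_apply (u : 𝕊 1) :
    (famLoop L A γ₀ hL 0).toFun u = (compLoop A γ₀ (L.framingPath A γ₀)).toFun u := by
  have h1 : famScalar L A γ₀ 0 = radiusRatio A γ₀ (L.framingPath A γ₀) := by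
    rw [famScalar, Real.smoothTransition.zero]; ring
  have h2 : famArg 0 (angA u) = Real.smoothTransition (2 * angA u) := by
    rw [famArg, Real.smoothTransition.zero]; ring
  rw [famLoop_toFun, compLoop_framingPath_apply, h1, h2, sub_zero, (basePath L hL).eq_self 1 le_rfl,
    matCLM_toMat]

/-- At `t = 1` the family is `L`. [folklore] -/
theorem famLoop_one_apply (u : 𝕊 1) : (famLoop L A γ₀ hL 1).toFun u = L.toFun u := by
  have h1 : famScalar L A γ₀ 1 = 1 := by
    rw [famScalar, Real.smoothTransition.one]; ring
  have h2 : famArg 1 (angA u) = angA u := by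
    rw [famArg, Real.smoothTransition.one]; ring
  rw [famLoop_toFun, h1, h2, sub_self, (basePath L hL).eq_one 0 le_rfl, matCLM_one, one_mul, one_smul,
    circlePt_angA]

/-- The family is jointly continuous. [folklore] -/
theorem continuous_famLoop_toFun :
    Continuous fun p : ℝ × (𝕊 1) ↦ (famLoop L A γ₀ hL p.1).toFun p.2 := by
  have hs : Continuous fun p : ℝ × (𝕊 1) ↦ famScalar L A γ₀ p.1 :=
    (continuous_famScalar L A γ₀).comp continuous_fst
  have hC : Continuous fun p : ℝ × (𝕊 1) ↦ matCLM ((basePath L hL).toFun (1 - p.1)) :=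
    continuous_matCLM.comp ((basePath L hL).continuous.comp (continuous_const.sub continuous_fst))
  exact hs.smul (hC.mul (continuous_comp_circlePt_famArg L.contMDiff_toFun))

/-- The inverse family is jointly continuous. [folklore] -/
theorem continuous_famLoop_inv :
    Continuous fun p : ℝ × (𝕊 1) ↦ (famLoop L A γ₀ hL p.1).inv p.2 := by
  have hs : Continuous fun p : ℝ × (𝕊 1) ↦ (famScalar L A γ₀ p.1)⁻¹ :=
    ((continuous_famScalar L A γ₀).comp continuous_fst).inv₀ fun p ↦ (famScalar_pos L A γ₀ p.1).ne'
  have hC : Continuous fun p : ℝ × (𝕊 1) ↦ matCLM ((basePath L hL).inv (1 - p.1)) := by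
    have : Continuous (basePath L hL).inv :=
      continuous_matrix fun i j ↦ ((basePath L hL).contDiff_inv_apply i j).continuous
    exact continuous_matCLM.comp (this.comp (continuous_const.sub continuous_fst))
  exact hs.smul ((continuous_comp_circlePt_famArg L.contMDiff_inv).mul hC)

/-- **A positively oriented loop is realised by a framing path**: for `det L(ptA) > 0`,
`((sectionCircleNbhd A γ₀).linTwist L).Surgered ≅ gompfSphere A γ_L` (family lemma along
`famLoop`, then the jet lemma `nonempty_diffeomorph_linTwist_compLoop_gompfSphere`). [cite: GompfAGT2010, §4 ¶2] [cite: GompfStipsiczGSM1999, §5.2] -/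
theorem nonempty_diffeomorph_linTwist_gompfSphere_framingPath :
    Nonempty (((sectionCircleNbhd A γ₀).linTwist L).Surgered ≃ₘ⟮𝓡 4, 𝓡 4⟯
      gompfSphere A (L.framingPath A γ₀)) := by
  set ν₀ := sectionCircleNbhd A γ₀ with hν₀
  -- `L ⇝ F 1 ⇝ F 0 ⇝ Q ⇝ γ_L`
  obtain ⟨e₁⟩ := (ν₀.linTwist L).nonempty_diffeomorph_surgered_of_eqOn (ν₀.linTwist (famLoop L A γ₀ hL 1))
    fun u w _ ↦ by rw [CircleNbhd.linTwist_apply, CircleNbhd.linTwist_apply, famLoop_one_apply]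
  obtain ⟨e₂⟩ := ν₀.nonempty_diffeomorph_surgered_linTwist_of_family (famLoop L A γ₀ hL)
    (continuous_famLoop_toFun L A γ₀ hL).continuousOn (continuous_famLoop_inv L A γ₀ hL).continuousOn
  obtain ⟨e₃⟩ := (ν₀.linTwist (famLoop L A γ₀ hL 0)).nonempty_diffeomorph_surgered_of_eqOn
    (ν₀.linTwist (compLoop A γ₀ (L.framingPath A γ₀)))
    fun u w _ ↦ by rw [CircleNbhd.linTwist_apply, CircleNbhd.linTwist_apply, famLoop_zero_apply]
  obtain ⟨e₄⟩ := nonempty_diffeomorph_linTwist_compLoop_gompfSphere A γ₀ (L.framingPath A γ₀)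
  exact ⟨e₁.trans (e₂.symm.trans (e₃.trans e₄))⟩

end Realise

/-! ### Orientation of a loop and the fibre reflection -/

section Orient

variable (L : OpLoop)

/-- The operators of a loop have nonzero determinant. [folklore] -/
theorem OpLoop.det_toFun_ne_zero (u : 𝕊 1) : LinearMap.det (L.toFun u : 𝔼 3 →ₗ[ℝ] 𝔼 3) ≠ 0 := by
  have h := congrArg (fun f : 𝔼 3 →L[ℝ] 𝔼 3 ↦ LinearMap.det (f : 𝔼 3 →ₗ[ℝ] 𝔼 3)) (L.mul_inv u)
  simp only [ContinuousLinearMap.toLinearMap_mul, map_mul, ContinuousLinearMap.one_def,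
    ContinuousLinearMap.coe_id, LinearMap.det_id] at h
  exact left_ne_zero_of_mul_eq_one h

/-- **The fibre reflection has determinant `-1`.** [folklore] -/
theorem det_reflectOp (v : 𝕊 2) : LinearMap.det (reflectOp v : 𝔼 3 →ₗ[ℝ] 𝔼 3) = -1 := by
  have hv : ((v : 𝕊 2) : 𝔼 3) ≠ 0 := by
    intro h
    have := norm_eq_of_mem_sphere v
    rw [h, norm_zero] at this
    exact zero_ne_one this
  have h := (Submodule.span ℝ {((v : 𝕊 2) : 𝔼 3)})ᗮ.det_reflection (𝕜 := ℝ)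
  rw [Submodule.orthogonal_orthogonal, finrank_span_singleton hv, pow_one] at h
  exact h

/-- Reflecting the fibre negates the determinant of the loop. [folklore] -/
theorem OpLoop.det_mulReflect_toFun (v : 𝕊 2) (u : 𝕊 1) :
    LinearMap.det ((L.mulReflect v).toFun u : 𝔼 3 →ₗ[ℝ] 𝔼 3) =
      -LinearMap.det (L.toFun u : 𝔼 3 →ₗ[ℝ] 𝔼 3) := by
  show LinearMap.det ((L.toFun u * reflectOp v : 𝔼 3 →L[ℝ] 𝔼 3) : 𝔼 3 →ₗ[ℝ] 𝔼 3) = _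
  rw [ContinuousLinearMap.toLinearMap_mul, map_mul, det_reflectOp, mul_neg, mul_one]

/-- **Every loop is, up to a fibre reflection (which does not change the surgery), positively
oriented at `ptA`.** [folklore] -/
theorem OpLoop.exists_det_pos {X : Type u} [TopologicalSpace X] [ChartedSpace (𝔼 4) X] [T2Space X]
    [IsManifold (𝓡 4) ∞ X] {c : 𝕊 1 → X} (ν : CircleNbhd (𝓡 4) c) :
    ∃ L' : OpLoop, 0 < LinearMap.det (L'.toFun ptA : 𝔼 3 →ₗ[ℝ] 𝔼 3) ∧
      Nonempty ((ν.linTwist L).Surgered ≃ₘ⟮𝓡 4, 𝓡 4⟯ (ν.linTwist L').Surgered) := by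
  rcases (L.det_toFun_ne_zero ptA).lt_or_gt with hneg | hpos
  · refine ⟨L.mulReflect (spherePt 2), ?_, ν.nonempty_diffeomorph_surgered_linTwist_mulReflect _ L⟩
    rw [OpLoop.det_mulReflect_toFun]
    linarith
  · exact ⟨L, hpos, ⟨Diffeomorph.refl _ _ _⟩⟩

end Orient

/-! ### Discharge of S -/

/-- **S holds: the framings of the section circle of the Cappell–Shaneson mapping torus.** Every
circle surgery `X` on `CSTorus A` along the standard section circle — any parametrisation `c` of it,
any tubular neighbourhood, any realisation of the gluing — is diffeomorphic to a concrete Gompf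
sphere `X^σ_A = gompfSphere A γ`: reparametrise the circle (`IsCircleSurgery.of_range_eq`), compare
the tube with the Gompf tube of a fixed `γ₀` (`CircleNbhd.exists_opLoop_nonempty_diffeomorph_surgered`,
uniqueness of tubular neighbourhoods), orient the framing loop by a fibre reflection
(`OpLoop.exists_det_pos`) and realise it by a framing path
(`nonempty_diffeomorph_linTwist_gompfSphere_framingPath`). Gompf 2010, §4 ¶2 ("the two
straightenings `σ` … determine … the two resulting diffeomorphism types … Changing the framing is
equivalent to changing `σ`"); Kosinski III.3; Gompf–Stipsicz §5.2. [cite: GompfAGT2010, §4 ¶2 (X^σ well defined; framings ↔ straightenings)] [cite: Kosinski1993, Ch. III §3, Thm (3.1), Thm (3.5)] [cite: GompfStipsiczGSM1999, §5.2] -/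
theorem gompf2010_sectionCircle_framings_holds : gompf2010_sectionCircle_framings.{u} := by
  intro A c hc hrange X _ _ _ _ _ _ hX
  obtain ⟨γ₀⟩ := nonempty_smoothMatrixPath_specialLinearGroup A
  -- 1. reparametrise the circle
  have h₀ : IsCircleSurgery (𝓡 4) (𝓡 4) (CSTorus A) X (sectionCircle A γ₀) :=
    hX.of_range_eq (sectionCircleNbhd A γ₀) (by rw [hrange, range_sectionCircle])
  obtain ⟨ν, hν⟩ := h₀
  obtain ⟨e₀⟩ := IsOpenGluing.nonempty_diffeomorph hν ν.isOpenGluing_surgered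
  -- 2. uniqueness of tubular neighbourhoods
  obtain ⟨L, ⟨e₁⟩⟩ := (sectionCircleNbhd A γ₀).exists_opLoop_nonempty_diffeomorph_surgered ν
  -- 3. orient the loop
  obtain ⟨L', hL', ⟨e₂⟩⟩ := L.exists_det_pos (sectionCircleNbhd A γ₀)
  -- 4. realise it by a framing path
  obtain ⟨e₃⟩ := nonempty_diffeomorph_linTwist_gompfSphere_framingPath L' A γ₀ hL'
  exact ⟨L'.framingPath A γ₀, ⟨e₀.trans (e₁.trans (e₂.trans e₃))⟩⟩

/-- **The classification of Cappell–Shaneson spheres by straightenings holds** (the named fact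
`gompf2010_straightening_classification` of `GompfFramedSpheres.lean`): every Cappell–Shaneson
sphere of `A` in the sense of the tree's predicate — any mapping torus of `torusDiffeomorph A`, any
parametrisation of the section circle, any tube, any realisation of the gluing — is diffeomorphic
to a concrete `X^σ_A = gompfSphere A γ` (Gompf 2010, §4 ¶2); from **S** and the reduction to the
concrete mapping torus (`gompf2010_straightening_classification_of_sectionCircle`). [cite: GompfAGT2010, §4 ¶2 (X^σ well defined; framings ↔ straightenings)] -/
theorem gompf2010_straightening_classification_holds : gompf2010_straightening_classification.{u} :=
  gompf2010_straightening_classification_of_sectionCircle gompf2010_sectionCircle_framings_holds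

end Literature.Topology.FourManifolds

/-! ### The leaf set of `nonempty_diffeomorph_sphere_four_of_isCappellShanesonSphereOf` after S -/

namespace Literature.Topology.FourManifolds

universe u

/-- Local notation: `𝔼 n` is the model Euclidean space `EuclideanSpace ℝ (Fin n)`. -/
local notation "𝔼 " n:arg => EuclideanSpace ℝ (Fin n)

variable (X : Type u) [TopologicalSpace X] [T2Space X] [SecondCountableTopology X]
  [ChartedSpace (𝔼 4) X] [IsManifold (𝓡 4) ∞ X] [CompactSpace X]

/-- **The current leaf set: the framed Theorem 2.1 and [AK1].**
`nonempty_diffeomorph_sphere_four_of_isCappellShanesonSphereOf X` (Gompf 2010, Examples 3.1(a): every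
Cappell–Shaneson sphere of `Aₘ`, either framing, is `S⁴`) from the three remaining geometric named
facts — the framed Theorem 2.1 for the Δ-moves **F** (`gompf2010_framedTwist`) and for the Δ₀-moves
**F₀** (`gompf2010_framedTwistZero`), and [AK1] (`akbulutKirby1979_linearStraightening`: the
untwisted `A₀`-sphere is `S⁴`) — the framings of the section circle (**S**, this file),
straightening-class invariance (**W**, `StraighteningInvariance.lean`), conjugation invariance
(**Cj**, `GompfConjInvariance.lean`) and the `π₁` leaves (`GompfTheorem43Proofs.lean`) being proved. [cite: GompfAGT2010, Examples 3.1(a)] -/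
theorem nonempty_diffeomorph_sphere_four_of_isCappellShanesonSphereOf_of_twist_AK
    (hF : gompf2010_framedTwist) (hF₀ : gompf2010_framedTwistZero)
    (hAK : akbulutKirby1979_linearStraightening) :
    nonempty_diffeomorph_sphere_four_of_isCappellShanesonSphereOf X :=
  nonempty_diffeomorph_sphere_four_of_isCappellShanesonSphereOf_of_geometric X
    gompf2010_sectionCircle_framings_holds gompf2010_sectionCircle_framings_holds
    gompf2010_straightening_invariance_holds gompf2010_conj_invariance_holds hF hF₀ hAK

end Literature.Topology.FourManifolds
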